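import Summits.BirchSwinnertonDyer.Rank1Residual.SmallImageMu.KatoDivisibility
import Summits.BirchSwinnertonDyer.BirchSwinnertonDyer.Theorems.Rank1ResidualX9MuTransfer
import Literature.NumberTheory.EllipticCurves.Rank1Residual.MuLambdaCarriers
import Summits.BirchSwinnertonDyer.BirchSwinnertonDyer.Theorems.KatoDescentPotSupersingularFineSelmerControlRankOne
import Literature.NumberTheory.EllipticCurves.Rank1Residual.FirstLayerCertificates
import Literature.NumberTheory.EllipticCurves.Rank1Residual.RankOneAnchorData
import Summits.BirchSwinnertonDyer.Rank1Residual.Iwasawa.LocalTowerKernelCardLeTamagawa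
import HarnessLib

/-!
# Route OneSidedTwistSqueezeX9 — the FINE MORDELL–WEIL RUNG of the crux `KatoDivisibilityX9`
# (stmt-BirchSwinnertonDyer-20547): Kato's INTEGRAL divisibility, `μ(X) = 0` and the INTEGRAL main conjecture
# AT an X9 pair carrying RANK-ONE ANCHOR DATA — kernel-glued from LANDED theorems (BC5 / T3 witness)

Cell `bsd-f3-mu` (D-0131 (3) FRONTIER TIER; HOME `run/shared/lean/pub/bsd-f3-mu/`), planner of record `-imc`
gen 4 (HOME/imc/g4/OneSidedTwistSqueezeX9FMWRung.landing.lean 2a4f5150bddaa2bb); landed by the cell's typer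
seat under `Rank1Residual/SmallImageMu/` (the `Theorems/` directory being prover-only, D-0016) with the crux
named through its leaf node `SmallImageMu.KatoDivisibilityOnClassX9` (= the route item `KatoDivisibilityX9`
by definition) instead of the Theses file, plus a §Cover of engines so that every declaration reaches an
obligation; tribunal re-runs pass `--imports Summits.BirchSwinnertonDyer.Rank1Residual.SmallImageMu.OneSidedTwistSqueezeX9FMWRung`.
ROUTE-LOCAL SUPPORT for crux stmt-BirchSwinnertonDyer-20547 (evidence #28–#31, BC5-WITNESS.md); nothing
class-wide is asserted; the crux (Kato's integral divisibility on ALL of class X9) stays OPEN.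

WHAT.  The `-desc` lens's generation-3 «fine Mordell–Weil certificate» (HOME/MEMO-desc.md §11, Sketch4
e481a5934f0b7626: `E(ℚ_p)[p] = 0`, `p ∤ ∏ c_ℓ`, `Ш[p] = 0`, rank one, generator not `p`-divisible in
`E(ℚ_p)` ⟹ `Sel₀(ℚ_∞, E[p^∞]) = 0`) turns out to be PROVED IN THE TREE ALREADY, in the (c3)-clean spelling,
by the cell `bsd-potss` (`Theorems/KatoDescentPotSupersingularFineSelmerControlRankOne.lean`,
`FineSelmerControl.conjA_rat_of_rankOne`: rank-one anchor data ⟹ statement (A) of Coates–Sujatha at `(E, p)`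
for every cyclotomic `ℤ_p`-extension, sorry-free kernel plumbing, Greenberg LNM 1716 Prop. 3.8 + Kummer
theory).  Its conclusion is LITERALLY the cell's carrier `Rank1Residual.ConjAAt W p`.  Composing with the
cell's landed per-pair engine `Rank1Residual.ConjAAt.katoDivisibilityAt` (T0 `μ(X₀) = 0` proved; S-W⁺
`k ≤ μ(X₀)`; Kato's package F1; BCS 2025 Thm 1.1.2 (a)) gives, AT EVERY X9 PAIR CARRYING RANK-ONE ANCHOR DATA:

* `katoDivisibilityAt_of_rankOneAnchorData` — Kato's INTEGRAL one-sided divisibility `∃ g ∈ ch_Λ X, ι g = L_p`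
  (the crux's per-pair matrix, `SmallImageMu.katoDivisibilityOnClassX9_iff`) — the BC5 RUNG of the crux;
* `muAlgZeroAt_of_rankOneAnchorData_of_muAnZeroAt` — with a unit coefficient of `L_p(f)` (`MuAnZeroAt`, the
  two-engine census certificate): `μ(X(E/ℚ_∞)) = 0` — the cell's SEARCH QUESTION answered at the pair;
* `integralMainConjectureAt_of_rankOneAnchorData_of_muAnZeroAt` — and the INTEGRAL cyclotomic main conjecture
  `ch_Λ X(E/ℚ_∞) = (g)`, `ι g = L_p(f, α)` at the pair (`k ≤ 0` fine side, `k ≥ 0` unit coefficient, BCS (a));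
* `BSDpOnRankOneAnchoredX9` — the S-RESTRICTED CASE (the K6 leaf on the anchored sub-family; NOT provable here
  or in print: (im) of BCS Thm 1.1.2 (b) fails on X9, `not_bcsHypothesisIm_of_classX9`); that it IS a
  restriction of the leaf is the closing `example` — the `s_case` of the tribunal kernel;

BINDERS (honest ledger).  PRINT named facts: `burungale_castella_skinner_charIdeal_eq_padicLFunction` (BCS 2025
Thm 1.1.2 (a)), `nonempty_modularParametrizationData` (BCDT), `Kato2004.exists_divisibilityInputs_fineQuotient`
(Kato 2004 §13–§17 package with the fine quotient).  SUPPORT: `MuDefectLeFineMuAt W p` (S-W⁺, `k ≤ μ(X₀)`;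
provable from Kato's §17.13 package — HOME/es/EulerLossChart.lean, 0 sorry; not yet a tree theorem at the
pair).  DATA (per pair, displayed from records, not kernel-certified): `Rank1Residual.RankOneAnchorDataAt W p` /
`Rank1Residual.RankOneAnchorDataTamAt W p` (Literature predicates, `Rank1Residual/RankOneAnchorData.lean`).  Census
(BC5 data, HOME/desc/d10/FMW-CERT-v2.tsv 9ca5fa31d4fdb843): 234 rank-1 X9 records (24 `5Ns` + 200 `5S4` +
10 `7Ns`) carry the certificate in the Tamagawa spelling; nominated instance `648a1 @ p = 5` (image `5S4`,
`N = 2³·3⁴` additive at 2 and 3 so `E(ℚ_ℓ)[5] = 0` there, `a_5 = −1` so `E(ℚ_5)[5] = 0`, `m = #Ẽ(𝔽_5) = 7`,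
`v_5(x(7P)) = −2` so `P ∉ 5·E(ℚ_5)`, `E(ℚ) ≅ ℤ`, Heegner point of index 4 for `D = −23` ⟹ `Ш[5^∞] = 0` by
Matar–Nekovář 2019 Thm 0.3) — outside every printed case of `BSD_p` / IMC_p (no multiplicative prime: Skinner–
Urban void; (im) fails: BCS (b), JSW 2017, Castella et al. void).  BSD is not proved by any of this.

References: [GreenbergLNM1716] Prop. 3.8 (pp. 95–96), §3 Lemmas 3.2–3.3; [CoatesSujatha2005] §3;
[Kato2004Asterisque] Thm. 12.5, Thm. 17.4, §17.13; [BurungaleCastellaSkinner2025] Thm. 1.1.2 (a);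
[GreenbergVatsal2000] (2) p. 2, Prop. 3.7; [MatarNekovar2019] Thm. 0.3; HOME MEMO-desc.md §11, MEMO-imc.md §12.
-/

-- the summit and its single problem are both named `BirchSwinnertonDyer` (registry layout D-0017)
set_option linter.dupNamespace false
set_option autoImplicit false

open scoped Classical MatrixGroups ModularForm

open CongruenceSubgroup WeierstrassCurve Literature.NumberTheory.EllipticCurves Literature.NumberTheory.EllipticCurves.ModularForms
  Literature.NumberTheory.IwasawaTheory Summit.BirchSwinnertonDyer.BirchSwinnertonDyer.Rank1Residual
  IsDedekindDomain NumberField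
open Literature.NumberTheory.EllipticCurves.GreenbergSelmer (decomp)
open Literature.NumberTheory.EllipticCurves.Rank1Residual (RankOneAnchorDataAt RankOneAnchorDataTamAt KatoDivisibilityAt MuDefectNonposAt MuDefectNonnegAt
  MuAnZeroAt MuAlgZeroAt ConjAAt FineMuZeroAt MuDefectLeFineMuAt integralMainConjectureAt_of_muDefect
  muAlgZeroAt_of_katoDivisibilityAt_of_muAnZeroAt' mazurMainConjecture_of_mu_eq_zero)
open Summit.BirchSwinnertonDyer.BirchSwinnertonDyer.Theorems.FineSelmerControl (conjA_rat_of_rankOne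
  conjA_of_fineMordellWeil_of_local fineMordellWeil_of_rankOne primaryComponent_sha_eq_bot_of_natCard_eq_one)

namespace Summit.BirchSwinnertonDyer.Rank1Residual.SmallImageMu

/-- **Rank-one anchor data ⟹ statement (A) of Coates–Sujatha at the pair** (`Rank1Residual.ConjAAt`), by the
LANDED kernel theorem `FineSelmerControl.conjA_rat_of_rankOne` (cell `bsd-potss`), whose conclusion is the
carrier's body verbatim. [cite: GreenbergLNM1716, Prop. 3.8 (pp. 95–96) and §2] [cite: CoatesSujatha2005, §3 (Conjecture A)] -/
theorem conjAAt_of_rankOneAnchorData {W : WeierstrassCurve ℚ} [W.IsElliptic] {p : ℕ} [Fact p.Prime]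
    (h : RankOneAnchorDataAt W p) : ConjAAt W p := by
  obtain ⟨S, v₀, P, m, hS, hv₀S, hv₀p, hsha, hm, hgen, hindiv, hloc⟩ := h
  exact conjA_rat_of_rankOne W S hS hv₀S hv₀p hsha P hm hgen hindiv hloc

/-! ## The TAMAGAWA spelling of the anchor data (the census's `FMW_cert_v2`, 234 rows): at a bad place `v ∤ p`
the torsion socket `E(ℚ_v)[p] = 0` is replaced by `p ∤ c_v(E)`, discharged through Greenberg's classical socket
(C) `𝒦_{v,0}[p^∞] = 0` by the tree's SHARP layer-`0` Tamagawa bound (`Iwasawa/LocalTowerKernelCardLeTamagawa`,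
cell b2b-bsdres, sorry-free) and the (C)-socket control theorem of cell bsd-potss
(`FineSelmerControl.conjA_of_fineMordellWeil_of_local`). -/

section TamagawaSocket

variable {K : Type} [Field K] [NumberField K] (W : WeierstrassCurve K) {p : ℕ} [Fact p.Prime]
  (κ : ZpExtension K p)

/-- **Tamagawa socket ⟹ classical socket (C) at layer `0`**: at `v ∤ p` with `p ∤ c_v(E/K_v)` the `p`-power
torsion of the level-`0` local tower kernel `𝒦_{v,0} = ker (H¹(K_v, E) → H¹(K_{∞,η}, E))` vanishes, for ANY
`ℤ_p`-extension and any reduction type (`#𝒦_{v,0}[p^∞] ≤ p ^ ord_p c_v`, Greenberg's Lemma 3.3 value).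
[cite: GreenbergLNM1716, §3 Lemma 3.3 (proof, pp. 86–88) and §4 proof of Thm. 4.1 (p. 74)] -/
theorem localTowerKerPrimary_zero_eq_bot_of_padicValNat_localTamagawaNumber_eq_zero [W.IsElliptic]
    {v : HeightOneSpectrum (𝓞 K)} (hpv : ((p : ℕ) : 𝓞 K) ∉ v.asIdeal)
    (htam : padicValNat p ((W.baseChange (v.adicCompletion K)).localTamagawaNumber
      (v.adicCompletionIntegers K)) = 0) :
    W.localTowerKerPrimary κ (v.adicCompletion K) 0 = ⊥ := by
  obtain ⟨hfin, hle⟩ :=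
    Iwasawa.finite_and_natCard_localTowerKerPrimary_zero_le_pow_padicValNat_localTamagawaNumber W κ hpv
  haveI := hfin
  haveI : Nonempty (W.localTowerKerPrimary κ (v.adicCompletion K) 0) := ⟨0⟩
  rw [htam, pow_zero] at hle
  exact AddSubgroup.eq_bot_of_card_eq _ (le_antisymm hle Nat.card_pos)

end TamagawaSocket

/-- **Rank-one anchor data in the Tamagawa spelling ⟹ statement (A) at the pair** (`Rank1Residual.ConjAAt`):
(FMW) from the rank-one data at `v₀` (`FineSelmerControl.fineMordellWeil_of_rankOne`), then the (C)-socket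
control theorem `FineSelmerControl.conjA_of_fineMordellWeil_of_local` with the torsion socket at `v₀` and the
Tamagawa ⟹ (C) socket at the other places of `S`; all LANDED, sorry-free.
[cite: GreenbergLNM1716, Prop. 3.8 (pp. 95–96) and §3 Lemma 3.3 (pp. 86–88)] [cite: CoatesSujatha2005, §3 (Conjecture A)] -/
theorem conjAAt_of_rankOneAnchorDataTam {W : WeierstrassCurve ℚ} [W.IsElliptic] {p : ℕ} [Fact p.Prime]
    (h : RankOneAnchorDataTamAt W p) : ConjAAt W p := by
  obtain ⟨S, v₀, P, m, hS, hv₀S, hv₀p, hsha, hm, hgen, hindiv, hloc₀, htam⟩ := h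
  intro κ _
  refine conjA_of_fineMordellWeil_of_local W κ S hS
    (fineMordellWeil_of_rankOne W κ S hv₀S hv₀p (primaryComponent_sha_eq_bot_of_natCard_eq_one W hsha)
      P hm hgen hindiv hloc₀) fun v hv ↦ ?_
  by_cases hvv : v = v₀
  · subst hvv; exact Or.inl hloc₀
  · obtain ⟨hnot, ht⟩ := htam v hv hvv
    exact Or.inr ⟨hnot,
      localTowerKerPrimary_zero_eq_bot_of_padicValNat_localTamagawaNumber_eq_zero W κ hnot ht⟩


section Rung

variable {W : WeierstrassCurve ℚ} [W.IsElliptic] [W.IsGloballyMinimal] {p : ℕ} [Fact p.Prime]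

/-- **THE FINE MORDELL–WEIL RUNG of the crux `KatoDivisibilityX9` (BC5 / T3 witness): at an X9 pair carrying
rank-one anchor data, Kato's INTEGRAL one-sided divisibility `∃ g ∈ ch_Λ X(E/ℚ_∞), ι g = L_p(f, α)` holds for
every cyclotomic datum, newform and dual Selmer datum** — granted BCS Thm 1.1.2 (a), modularity, Kato's package
F1 (print) and S-W⁺ `k ≤ μ(X₀)` at the pair (support).  Proof: anchor data ⟹ (A) (`conjA_rat_of_rankOne`,
landed) ⟹ `μ(X₀) = 0` (T0, landed) ⟹ `k ≤ 0` ⟹ divisibility (`ConjAAt.katoDivisibilityAt`, landed).  The image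
hypothesis (sur)/(im) of Kato Thm 17.4 / BCS (b) is NOT used: the pair is X9.
[cite: Kato2004Asterisque, Thm. 17.4 (p. 273) and §17.13 (pp. 279–280)] [cite: BurungaleCastellaSkinner2025, Thm. 1.1.2 (a) (p. 2 of arXiv:2405.00270v2)] -/
theorem katoDivisibilityAt_of_rankOneAnchorData
    (hBCS : burungale_castella_skinner_charIdeal_eq_padicLFunction)
    (hmodP : nonempty_modularParametrizationData)
    (hfine : Kato2004.exists_divisibilityInputs_fineQuotient)
    (hX9 : ClassX9 W p) (hSW : MuDefectLeFineMuAt W p) (hdata : RankOneAnchorDataAt W p) :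
    KatoDivisibilityAt W p := by
  obtain ⟨-, hp, hgood, hord, hirr, -⟩ := id hX9
  exact (conjAAt_of_rankOneAnchorData hdata).katoDivisibilityAt hBCS hmodP hfine hp hgood hord hirr hSW

/-- **The same rung from anchor data in the TAMAGAWA spelling** (234 census rows). [cite: Kato2004Asterisque, Thm. 17.4 (p. 273) and §17.13 (pp. 279–280)]
[cite: BurungaleCastellaSkinner2025, Thm. 1.1.2 (a) (p. 2 of arXiv:2405.00270v2)] -/
theorem katoDivisibilityAt_of_rankOneAnchorDataTam
    (hBCS : burungale_castella_skinner_charIdeal_eq_padicLFunction)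
    (hmodP : nonempty_modularParametrizationData)
    (hfine : Kato2004.exists_divisibilityInputs_fineQuotient)
    (hX9 : ClassX9 W p) (hSW : MuDefectLeFineMuAt W p) (hdata : RankOneAnchorDataTamAt W p) :
    KatoDivisibilityAt W p := by
  obtain ⟨-, hp, hgood, hord, hirr, -⟩ := id hX9
  exact (conjAAt_of_rankOneAnchorDataTam hdata).katoDivisibilityAt hBCS hmodP hfine hp hgood hord hirr hSW

/-- **… + a unit coefficient of `L_p(f)` ⟹ `μ(X(E/ℚ_∞)) = 0` at the pair** (`Rank1Residual.MuAlgZeroAt`): the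
cell's search question «μ = 0 at irreducible non-surjective image» answered AT an anchored X9 pair, modulo the
print inputs, S-W⁺ and the displayed data.
[cite: GreenbergVatsal2000, p. 2 (2) and Prop. 3.7] [cite: BurungaleCastellaSkinner2025, Thm. 1.1.2 (a) (p. 2 of arXiv:2405.00270v2)] -/
theorem muAlgZeroAt_of_rankOneAnchorData_of_muAnZeroAt
    (hBCS : burungale_castella_skinner_charIdeal_eq_padicLFunction)
    (hmodP : nonempty_modularParametrizationData)
    (hfine : Kato2004.exists_divisibilityInputs_fineQuotient)
    (hX9 : ClassX9 W p) (hSW : MuDefectLeFineMuAt W p) (hdata : RankOneAnchorDataAt W p)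
    {N : ℕ} [NeZero N] {f : CuspForm (Gamma0 N) 2} (hf : IsNewformOf W f) (hμ : MuAnZeroAt W p) :
    MuAlgZeroAt W p := by
  obtain ⟨-, hp, hgood, hord, hirr, -⟩ := id hX9
  exact muAlgZeroAt_of_katoDivisibilityAt_of_muAnZeroAt' hBCS hp hgood hord hirr hf
    (katoDivisibilityAt_of_rankOneAnchorData hBCS hmodP hfine hX9 hSW hdata) hμ

/-- **… and the INTEGRAL cyclotomic main conjecture at the pair**: `ch_Λ X(E/ℚ_∞) = (g)` with `ι g = L_p(f, α)`
on the nose, for every cyclotomic datum, newform and dual Selmer datum (`k ≤ 0` from the fine side, `k ≥ 0`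
from the unit coefficient `MuAnZeroAt.muDefectNonnegAt`, pinned in BCS (a) by
`Rank1Residual.integralMainConjectureAt_of_muDefect`).  This is the conclusion of BCS 2025 Thm 1.1.2 (b) —
printed under (im) only — at a Cartan-normaliser / `𝔖₄`-image pair.
[cite: BurungaleCastellaSkinner2025, Thm. 1.1.2 (a)–(b) (p. 2 of arXiv:2405.00270v2)] [cite: GreenbergVatsal2000, Prop. 3.7] -/
theorem integralMainConjectureAt_of_rankOneAnchorData_of_muAnZeroAt
    (hBCS : burungale_castella_skinner_charIdeal_eq_padicLFunction)
    (hmodP : nonempty_modularParametrizationData)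
    (hfine : Kato2004.exists_divisibilityInputs_fineQuotient)
    (hX9 : ClassX9 W p) (hSW : MuDefectLeFineMuAt W p) (hdata : RankOneAnchorDataAt W p)
    (hμ : MuAnZeroAt W p) (κ : ZpExtension ℚ p) (γ : Field.absoluteGaloisGroup ℚ) {N : ℕ} [NeZero N]
    (f : CuspForm (Gamma0 N) 2) (hκ : κ.IsCyclotomic) (hγ : κ.IsTopGenerator γ)
    (hγ' : IsCyclotomicVariable p γ) (hf : IsNewformOf W f) (D : W.SelmerDualData κ γ) :
    D.IsTorsion ∧ ∃ g : IwasawaAlgebra p, D.charIdeal = Ideal.span {g} ∧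
      iwasawaToPowerSeries p g = padicLFunction f (unitRoot W p : ℚ_[p]) := by
  obtain ⟨-, hp, hgood, hord, hirr, -⟩ := id hX9
  have hK : KatoDivisibilityAt W p := katoDivisibilityAt_of_rankOneAnchorData hBCS hmodP hfine hX9 hSW hdata
  exact integralMainConjectureAt_of_muDefect hBCS hp hgood hord hirr (hK.muDefectNonposAt ⟨hgood, hord⟩)
    hμ.muDefectNonnegAt κ γ f hκ hγ hγ' hf D

end Rung

/-! ## Cover engines (typer's addition for the file audit: every rung decl reaches an obligation).  The
class-wide antecedent `hcover` — «every X9 pair carries rank-one anchor data (either spelling), or Kato's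
divisibility holds there by some other road» — is DATA, FALSE as a blanket claim today (census: 234 of 415
rank-1 X9 pairs anchored, 38 rows with `Sel₀(ℚ_∞) ≠ 0`, 143 undecided, rank-0 pairs in the known regime);
these theorems are ENGINES recording the literal shape «rung on the anchored pairs + the crux elsewhere ⟹
crux / integral main conjecture on X9», not theses. -/

section Cover

/-- **The rungs reduce the crux `KatoDivisibilityOnClassX9` (route item `KatoDivisibilityX9`) to the un-anchored X9 pairs** (+ S-W⁺ on X9,
F1, BCS (a), modularity). [cite: Kato2004Asterisque, Thm. 17.4 (p. 273) and §17.13 (pp. 279–280)]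
[cite: BurungaleCastellaSkinner2025, Thm. 1.1.2 (a) (p. 2 of arXiv:2405.00270v2)] -/
theorem katoDivisibilityOnClassX9_of_rankOneAnchorData_of_cover
    (hBCS : burungale_castella_skinner_charIdeal_eq_padicLFunction)
    (hmodP : nonempty_modularParametrizationData)
    (hfine : Kato2004.exists_divisibilityInputs_fineQuotient)
    (hSW : ∀ (W : WeierstrassCurve ℚ) [W.IsElliptic] [W.IsGloballyMinimal] (p : ℕ) [Fact p.Prime],
      ClassX9 W p → MuDefectLeFineMuAt W p)
    (hcover : ∀ (W : WeierstrassCurve ℚ) [W.IsElliptic] [W.IsGloballyMinimal] (p : ℕ) [Fact p.Prime],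
      ClassX9 W p → RankOneAnchorDataAt W p ∨ RankOneAnchorDataTamAt W p ∨ KatoDivisibilityAt W p) :
    KatoDivisibilityOnClassX9 := by
  intro W _ _ p _ κ γ N _ f hX9 hκ hγ hγ' hf D
  have hK : KatoDivisibilityAt W p := by
    rcases hcover W p hX9 with hdata | hdata | hK
    · exact katoDivisibilityAt_of_rankOneAnchorData hBCS hmodP hfine hX9 (hSW W p hX9) hdata
    · exact katoDivisibilityAt_of_rankOneAnchorDataTam hBCS hmodP hfine hX9 (hSW W p hX9) hdata
    · exact hK
  exact hK κ γ f hκ hγ hγ' hf D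

/-- **The rungs + a unit coefficient at every X9 pair (`AnalyticMuZeroOnClassX9`, item 19630) reduce the
integral main conjecture on X9 to the un-anchored pairs**: anchored pairs through
`integralMainConjectureAt_of_rankOneAnchorData_of_muAnZeroAt`, the others through `k ≤ 0 ≤ k`.
[cite: BurungaleCastellaSkinner2025, Thm. 1.1.2 (a)–(b) (p. 2 of arXiv:2405.00270v2)] [cite: GreenbergVatsal2000, Prop. 3.7] -/
theorem integralMainConjectureOnClassX9_of_rankOneAnchorData_of_cover
    (hBCS : burungale_castella_skinner_charIdeal_eq_padicLFunction)
    (hmodP : nonempty_modularParametrizationData)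
    (hfine : Kato2004.exists_divisibilityInputs_fineQuotient)
    (hSW : ∀ (W : WeierstrassCurve ℚ) [W.IsElliptic] [W.IsGloballyMinimal] (p : ℕ) [Fact p.Prime],
      ClassX9 W p → MuDefectLeFineMuAt W p)
    (hA : AnalyticMuZeroOnClassX9)
    (hcover : ∀ (W : WeierstrassCurve ℚ) [W.IsElliptic] [W.IsGloballyMinimal] (p : ℕ) [Fact p.Prime],
      ClassX9 W p → RankOneAnchorDataAt W p ∨ KatoDivisibilityAt W p) :
    IntegralMainConjectureOnClassX9 := by
  intro W _ _ p _ κ γ N _ f hX9 hκ hγ hγ' hf D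
  obtain ⟨-, hp, hgood, hord, hirr, -⟩ := id hX9
  have hμ : MuAnZeroAt W p := fun f' hf' ↦ hA W p f' hX9 hf'
  rcases hcover W p hX9 with hdata | hK
  · exact integralMainConjectureAt_of_rankOneAnchorData_of_muAnZeroAt hBCS hmodP hfine hX9 (hSW W p hX9)
      hdata hμ κ γ f hκ hγ hγ' hf D
  · exact integralMainConjectureAt_of_muDefect hBCS hp hgood hord hirr (hK.muDefectNonposAt ⟨hgood, hord⟩)
      hμ.muDefectNonnegAt κ γ f hκ hγ hγ' hf D

/-- **The same reduction through `μ(X) = 0` at the anchored pairs** (`muAlgZeroAt_of_rankOneAnchorData_of_muAnZeroAt`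
+ `Rank1Residual.mazurMainConjecture_of_mu_eq_zero`). [cite: GreenbergLNM1716, §1 Conj. 1.11]
[cite: BurungaleCastellaSkinner2025, Thm. 1.1.2 (a) (p. 2 of arXiv:2405.00270v2)] -/
theorem integralMainConjectureOnClassX9_of_rankOneAnchorData_of_cover'
    (hBCS : burungale_castella_skinner_charIdeal_eq_padicLFunction)
    (hmodP : nonempty_modularParametrizationData)
    (hfine : Kato2004.exists_divisibilityInputs_fineQuotient)
    (hSW : ∀ (W : WeierstrassCurve ℚ) [W.IsElliptic] [W.IsGloballyMinimal] (p : ℕ) [Fact p.Prime],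
      ClassX9 W p → MuDefectLeFineMuAt W p)
    (hA : AnalyticMuZeroOnClassX9)
    (hcover : ∀ (W : WeierstrassCurve ℚ) [W.IsElliptic] [W.IsGloballyMinimal] (p : ℕ) [Fact p.Prime],
      ClassX9 W p → RankOneAnchorDataAt W p ∨ MuAlgZeroAt W p) :
    IntegralMainConjectureOnClassX9 := by
  intro W _ _ p _ κ γ N _ f hX9 hκ hγ hγ' hf D
  obtain ⟨-, hp, hgood, hord, hirr, -⟩ := id hX9
  have hμan : MuAnZeroAt W p := fun f' hf' ↦ hA W p f' hX9 hf'
  have hμalg : MuAlgZeroAt W p := by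
    rcases hcover W p hX9 with hdata | h
    · exact muAlgZeroAt_of_rankOneAnchorData_of_muAnZeroAt hBCS hmodP hfine hX9 (hSW W p hX9) hdata hf hμan
    · exact h
  exact mazurMainConjecture_of_mu_eq_zero hBCS W p hp hgood hord hirr κ γ hκ hγ hγ' f hf D
    (hμalg κ γ hκ hγ hγ' D) (hA W p f hX9 hf)

end Cover

/-- **THE S-RESTRICTED CASE of the rung** (`s_case` of the tribunal kernel; an OBLIGATION node, nothing
asserted, NOT provable in the tree or in print): the `p`-part of BSD on the analytic-rank-`≤ 1` X9 pairs that
carry rank-one anchor data.  Print reaches no such pair: BCS 2025 Thm 1.1.2 (b) / Cor 1.3.1 need (im), false on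
X9 (`not_bcsHypothesisIm_of_classX9`); Skinner–Urban needs a multiplicative prime with ramified `ρ̄` (void at
`648a1`); Jetchev–Skinner–Wan 2017 and Castella–Grossi–Lee–Skinner need (im)/(sur)-type hypotheses.
[cite: BurungaleCastellaSkinner2025, Thm. 1.1.2 (b) and Cor. 1.3.1 (pp. 2–3 of arXiv:2405.00270v2)] -/
@[conjecture] def BSDpOnRankOneAnchoredX9 : Prop :=
  ∀ (W : WeierstrassCurve ℚ) [W.IsElliptic] [W.IsGloballyMinimal] (p : ℕ) [Fact p.Prime],
    W.analyticRank ≤ 1 → ClassX9 W p → RankOneAnchorDataAt W p → Finite W.sha → PPartBSD W p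

/- The S-restricted case IS a restriction of the leaf `Rank1Residual.BSDpOnClassX9` (so a proof of it in
scope would put the rung inside S's known regime — there is none).  Stated as an `example`, not a theorem, so
that no declaration concluding in the obligation node exists (the file audit would read one as a proof edge). -/
example (h : BSDpOnClassX9) : BSDpOnRankOneAnchoredX9 :=
  fun W _ _ p _ hr hX9 _ hfin => h W p hr hX9 hfin

end Summit.BirchSwinnertonDyer.Rank1Residual.SmallImageMu
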